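import Mathlib
import Literature.Analysis.FluidPDE.TypeIAncientMild
import Literature.Analysis.FluidPDE.SpaceTimeCalculus
import Summits.NavierStokesRegularity.NavierStokesRegularity.Theorems.SymmetryModuliCountForcedSymmetryInteriorVertexVanishing
import HarnessLib

/-!
# Route SymmetryModuliCount — a rigid co-motion is fatal (rigid co-motion vanishing)

Theorems file serving the crux item stmt-NavierStokesRegularity-4052
(`Summit.NavierStokesRegularity.NavierStokesRegularity.Theses.SymmetryModuliCount.ForcedSymmetry`),
line `time-anchor-bootstrap`, registered stub 4 `stub_rigidComotionVanishing`:

* if a Type-I KNSS-mild ancient field `u ∈ A_C` (`IsTypeIAncientMild C u`) is annihilated on the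
  open slab `t < 0` by a rigid co-motion `τ∂ₜ + (a + Ax)·∇ − A` with `τ ≠ 0` and `A` skew
  (`⟪Ax, x⟫ = 0`) — steady states, travelling and rotating waves in a co-moving frame —
  i.e. `D(u t)(x)(a + Ax) + τ ∂ₜu − Au = 0`, then `u ≡ 0` on `t < 0`.

## Proof (characteristics + the Type-I rate at `t → −∞`)

Dividing by `τ` we may take `τ = 1` (`b = τ⁻¹a`, `B = τ⁻¹A`, still skew). Fix `t₀ < 0`, `x₀`.

1. *Characteristic.* The flow of the complete affine field `y ↦ b + By` through `x₀` in closed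
   form, `x(s) = x₀ + ∫₀ˢ e^{ρB} w dρ` with `w = b + Bx₀` (`NormedSpace.exp` in the Banach algebra
   `E →L[ℝ] E`): `x' = e^{sB} w` (FTC-1 for the continuous integrand) and
   `b + B x(s) = w + ∫₀ˢ B e^{ρB} w dρ = w + [e^{ρB} w]₀ˢ = e^{sB} w` (FTC-2, `B` commuting with the
   integral), so `x' = b + Bx` (`comotion_hasDerivAt_flow`, `comotion_apply_integral_exp_smul`);
   time component `t(s) = t₀ + s`.
2. *Restriction.* `v(s) = u(t₀ + s, x(s))`, `s ≤ 0`; by the chain rule through `uncurry u`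
   (the sibling file's `vertex_hasDerivAt_along`) and the generator identity at `t = t₀ + s < 0`,
   `v' = ∂ₜu + D(u t)(x)(b + Bx) = Bv`.
3. *Energy.* `d/ds ‖v‖² = 2⟪v, Bv⟫ = 0`, so `‖v(s)‖ = ‖u(t₀, x₀)‖` for `s ≤ 0` (mean value
   inequality on the convex set `(-∞, 0]`).
4. *Type I.* `‖u(t₀, x₀)‖ = ‖u(t₀ − R², x(−R²))‖ ≤ C/√(R² − t₀) ≤ C/R` for every `R > 0`
   (`HasTypeITimeDecay`); with `R = C/‖u(t₀,x₀)‖ + 1` this is absurd unless `u(t₀, x₀) = 0`.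

Only joint differentiability of `uncurry u` on `(-∞,0) × E` (projection
`IsTypeIAncientMild.contDiffOn`) and the Type-I rate (`IsTypeIAncientMild.hasTypeITimeDecay`) are
used; constants are rigid co-movers and are excluded exactly by the rate. The analytic core is
stated for any complete real inner product space `E` (`comotion_vanishing_of_differentiableOn`)
and then specialised to `ℝ³` verbatim in the registered signature.

## References

Elementary (method of characteristics for a first-order linear transport identity); no published
source is followed. Skeleton: `Cruxes/ForcedSymmetry/Lines/time-anchor-bootstrap.lean`, stub 4.
-/

noncomputable section

-- the summit and its single sub-problem share the name (CONVENTIONS §1), as in every Theorems file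
set_option linter.dupNamespace false

open Set Filter Topology Function
open Literature.Analysis.FluidPDE
open scoped RealInnerProductSpace

namespace Summit.NavierStokesRegularity.NavierStokesRegularity.Theorems

variable {E : Type*} [NormedAddCommGroup E] [InnerProductSpace ℝ E]

/-- **The one-parameter group of a bounded generator, applied to a vector**: `s ↦ e^{sB} w` has
derivative `B e^{sB} w` at every `s` (Mathlib `hasDerivAt_exp_smul_const'`). [folklore] -/
theorem comotion_hasDerivAt_exp_smul_apply [CompleteSpace E] (B : E →L[ℝ] E) (w : E) (s : ℝ) :
    HasDerivAt (fun ρ : ℝ => NormedSpace.exp (ρ • B) w) (B (NormedSpace.exp (s • B) w)) s := by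
  have h := (hasDerivAt_exp_smul_const' (𝕂 := ℝ) B s).clm_apply (hasDerivAt_const s w)
  simpa using h

/-- `s ↦ e^{sB} w` is continuous (it is differentiable). [folklore] -/
theorem comotion_continuous_exp_smul_apply [CompleteSpace E] (B : E →L[ℝ] E) (w : E) :
    Continuous fun ρ : ℝ => NormedSpace.exp (ρ • B) w :=
  continuous_iff_continuousAt.2 fun s => (comotion_hasDerivAt_exp_smul_apply B w s).continuousAt

/-- **FTC-2 for the group**: `B ∫₀ˢ e^{ρB} w dρ = ∫₀ˢ B e^{ρB} w dρ = e^{sB} w − w` (`B` commutes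
with the Bochner integral; `d/dρ e^{ρB} w = B e^{ρB} w`). [folklore] -/
theorem comotion_apply_integral_exp_smul [CompleteSpace E] (B : E →L[ℝ] E) (w : E) (s : ℝ) :
    B (∫ ρ in (0 : ℝ)..s, NormedSpace.exp (ρ • B) w) = NormedSpace.exp (s • B) w - w := by
  have hc := comotion_continuous_exp_smul_apply B w
  rw [← B.intervalIntegral_comp_comm (hc.intervalIntegrable 0 s),
    intervalIntegral.integral_eq_sub_of_hasDerivAt
      (f := fun ρ : ℝ => NormedSpace.exp (ρ • B) w)
      (f' := fun ρ : ℝ => B (NormedSpace.exp (ρ • B) w))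
      (fun ρ _ => comotion_hasDerivAt_exp_smul_apply B w ρ)
      ((B.continuous.comp hc).intervalIntegrable 0 s)]
  simp

/-- **The flow of a complete affine field in closed form.** For `w = b + Bx₀`, the curve
`x(s) = x₀ + ∫₀ˢ e^{ρB} w dρ` solves `x' = b + Bx` (FTC-1: `x' = e^{sB} w`, and
`b + B x(s) = w + (e^{sB} w − w) = e^{sB} w` by `comotion_apply_integral_exp_smul`). [folklore] -/
theorem comotion_hasDerivAt_flow [CompleteSpace E] (B : E →L[ℝ] E) (b x₀ : E) (s : ℝ) :
    HasDerivAt (fun r : ℝ => x₀ + ∫ ρ in (0 : ℝ)..r, NormedSpace.exp (ρ • B) (b + B x₀))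
      (b + B (x₀ + ∫ ρ in (0 : ℝ)..s, NormedSpace.exp (ρ • B) (b + B x₀))) s := by
  have e : b + B (x₀ + ∫ ρ in (0 : ℝ)..s, NormedSpace.exp (ρ • B) (b + B x₀)) =
      NormedSpace.exp (s • B) (b + B x₀) := by
    rw [map_add, comotion_apply_integral_exp_smul]
    abel
  rw [e]
  exact ((comotion_continuous_exp_smul_apply B (b + B x₀)).integral_hasStrictDerivAt 0 s)
    |>.hasDerivAt.const_add x₀

/-- **Rigid co-motion vanishing, analytic core** (any complete real inner product space, `τ = 1`).
Let `uncurry u` be differentiable on the open slab `(-∞, 0) × E`, obey the Type-I rate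
`‖u(t, x)‖ ≤ C/√(−t)`, and be annihilated on `t < 0` by `∂ₜ + (b + Bx)·∇ − B` with `B` skew:
`D(u t)(x)(b + Bx) + ∂ₜu − Bu = 0`. Then `u ≡ 0` on `t < 0`: along the characteristic
`s ↦ (t₀ + s, x(s))` of step 1 of the module docstring, `‖u‖` is constant (`v' = Bv`,
`⟪Bv, v⟫ = 0`), and the Type-I rate at `s → −∞` forces the constant to vanish. [folklore] -/
theorem comotion_vanishing_of_differentiableOn [CompleteSpace E]
    {u : ℝ → E → E} (hd : DifferentiableOn ℝ (uncurry u) (Iio 0 ×ˢ univ))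
    {C : ℝ} (hCu : HasTypeITimeDecay C u) {b : E} {B : E →L[ℝ] E} (hB : ∀ x, ⟪B x, x⟫ = 0)
    (hgen : ∀ t < 0, ∀ x, fderiv ℝ (u t) x (b + B x) + timeDeriv u t x - B (u t x) = 0) :
    ∀ t < 0, ∀ x, u t x = 0 := by
  intro t₀ ht₀ x₀
  -- Step 1: the characteristic through `(t₀, x₀)`
  obtain ⟨tc, htc_def⟩ : ∃ tc : ℝ → ℝ, tc = fun s => t₀ + s := ⟨_, rfl⟩
  obtain ⟨xc, hxc_def⟩ : ∃ xc : ℝ → E,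
      xc = fun s => x₀ + ∫ ρ in (0 : ℝ)..s, NormedSpace.exp (ρ • B) (b + B x₀) := ⟨_, rfl⟩
  have htcs : ∀ s, tc s = t₀ + s := fun s => by rw [htc_def]
  have htc0 : tc 0 = t₀ := by rw [htcs, add_zero]
  have hxc0 : xc 0 = x₀ := by simp [hxc_def]
  have htc' : ∀ s, HasDerivAt tc 1 s := fun s => by
    rw [htc_def]
    exact (hasDerivAt_id' s).const_add t₀
  have hxc' : ∀ s, HasDerivAt xc (b + B (xc s)) s := fun s => by
    rw [hxc_def]
    exact comotion_hasDerivAt_flow B b x₀ s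
  have hU : IsOpen (Iio (0 : ℝ) ×ˢ (univ : Set E)) := isOpen_Iio.prod isOpen_univ
  -- Steps 2–3: along the characteristic `v' = Bv`, so `‖v‖²` is stationary on `s ≤ 0`
  have hφ : ∀ s ≤ (0 : ℝ), HasDerivAt (fun r => ‖u (tc r) (xc r)‖ ^ 2) 0 s := by
    intro s hs
    have hts : tc s < 0 := by rw [htcs]; linarith
    have hmem : (tc s, xc s) ∈ Iio (0 : ℝ) ×ˢ (univ : Set E) := ⟨hts, mem_univ _⟩
    have hL := ((hd _ hmem).differentiableAt (hU.mem_nhds hmem)).hasFDerivAt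
    have hv := vertex_hasDerivAt_along hL (htc' s) (hxc' s)
    have hv2 : HasDerivAt (fun r => u (tc r) (xc r)) (B (u (tc s) (xc s))) s := by
      refine hv.congr_deriv ?_
      rw [one_smul, add_comm]
      exact sub_eq_zero.1 (hgen (tc s) hts (xc s))
    have h := hv2.norm_sq
    rw [real_inner_comm, hB, mul_zero] at h
    exact h
  have hconst : ∀ s ≤ (0 : ℝ), ‖u (tc s) (xc s)‖ ^ 2 = ‖u t₀ x₀‖ ^ 2 := by
    intro s hs
    have h := (convex_Iic (0 : ℝ)).norm_image_sub_le_of_norm_hasDerivWithin_le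
      (f := fun r => ‖u (tc r) (xc r)‖ ^ 2) (f' := fun _ => (0 : ℝ)) (C := 0)
      (fun r hr => (hφ r hr).hasDerivWithinAt) (fun _ _ => by rw [norm_zero]) hs Set.self_mem_Iic
    simp only [zero_mul, norm_le_zero_iff, sub_eq_zero] at h
    rw [← h, htc0, hxc0]
  have hnorm : ∀ s ≤ (0 : ℝ), ‖u (tc s) (xc s)‖ = ‖u t₀ x₀‖ := fun s hs =>
    (sq_eq_sq₀ (norm_nonneg _) (norm_nonneg _)).1 (hconst s hs)
  -- Step 4: the Type-I rate at `s = -R²`, `R = C/‖u t₀ x₀‖ + 1`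
  by_contra hne
  have hpos : 0 < ‖u t₀ x₀‖ := norm_pos_iff.2 hne
  obtain ⟨R, hR⟩ : ∃ R : ℝ, R = C / ‖u t₀ x₀‖ + 1 := ⟨_, rfl⟩
  have hs : -(R ^ 2) ≤ (0 : ℝ) := neg_nonpos.2 (sq_nonneg R)
  have hts : tc (-(R ^ 2)) < 0 := by rw [htcs]; linarith [sq_nonneg R]
  have key := hCu (tc (-(R ^ 2))) hts (xc (-(R ^ 2)))
  rw [hnorm _ hs] at key
  have hsqrt : 0 < Real.sqrt (-tc (-(R ^ 2))) := Real.sqrt_pos.2 (neg_pos.2 hts)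
  have hRle : R ≤ Real.sqrt (-tc (-(R ^ 2))) :=
    Real.le_sqrt_of_sq_le (by rw [htcs]; linarith)
  have h1 : ‖u t₀ x₀‖ * Real.sqrt (-tc (-(R ^ 2))) ≤ C := (le_div_iff₀ hsqrt).1 key
  have h2 : ‖u t₀ x₀‖ * R ≤ C := (mul_le_mul_of_nonneg_left hRle hpos.le).trans h1
  have e : ‖u t₀ x₀‖ * R = C + ‖u t₀ x₀‖ := by
    rw [hR, mul_add, mul_one, mul_div_cancel₀ _ hpos.ne']
  linarith

/-- **Registered stub 4 of line `time-anchor-bootstrap` (rigid co-motion vanishes).** If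
`u ∈ A_C` (`IsTypeIAncientMild C u`) is annihilated on `t < 0` by a rigid co-motion
`τ∂ₜ + (a + Ax)·∇ − A` with `τ ≠ 0` and `A` skew, then `u ≡ 0` on `t < 0`. Divide the generator
identity by `τ` (`b = τ⁻¹a`, `B = τ⁻¹A` is skew) and apply the analytic core
`comotion_vanishing_of_differentiableOn` to the joint smoothness of `u` on the open slab
(`IsTypeIAncientMild.contDiffOn`) and its Type-I rate (`IsTypeIAncientMild.hasTypeITimeDecay`);
the Oseen identity and incompressibility are not used. Signature =
`Sig.stub_rigidComotionVanishing` of the skeleton, verbatim. [folklore] -/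
theorem stub_rigidComotionVanishing :
    ∀ (C : ℝ) (u : ℝ → EuclideanSpace ℝ (Fin 3) → EuclideanSpace ℝ (Fin 3)),
      Literature.Analysis.FluidPDE.IsTypeIAncientMild C u →
      ∀ (a : EuclideanSpace ℝ (Fin 3)) (A : EuclideanSpace ℝ (Fin 3) →L[ℝ] EuclideanSpace ℝ (Fin 3)) (τ : ℝ),
        (∀ x, inner ℝ (A x) x = 0) → τ ≠ 0 →
        (∀ t < 0, ∀ x, fderiv ℝ (u t) x (a + A x) + τ • Literature.Analysis.FluidPDE.timeDeriv u t x
          - A (u t x) = 0) →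
        ∀ t < 0, ∀ x, u t x = 0 := by
  intro C u hu a A τ hA hτ hgen
  refine comotion_vanishing_of_differentiableOn (hu.contDiffOn.differentiableOn (by simp))
    hu.hasTypeITimeDecay (b := τ⁻¹ • a) (B := τ⁻¹ • A) (fun x => ?_) fun t ht x => ?_
  · rw [smul_apply, real_inner_smul_left, hA x, mul_zero]
  · rw [smul_apply, smul_apply, ← smul_add, map_smul]
    calc τ⁻¹ • fderiv ℝ (u t) x (a + A x) + timeDeriv u t x - τ⁻¹ • A (u t x)
        = τ⁻¹ • (fderiv ℝ (u t) x (a + A x) + τ • timeDeriv u t x - A (u t x)) := by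
          rw [smul_sub, smul_add, smul_smul, inv_mul_cancel₀ hτ, one_smul]
      _ = 0 := by rw [hgen t ht x, smul_zero]

end Summit.NavierStokesRegularity.NavierStokesRegularity.Theorems

end
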